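import Summits.QuantumFields.YangMills.Theorems.LuscherReductionTwistedTraceScalingToronSpectrum
import Summits.QuantumFields.YangMills.Theorems.LuscherReductionTwistedTraceScalingToronCurl
import HarnessLib

/-!
# C3a SPECTRAL BRIDGE: the covariant Hessian `D_{V_θ}†D_{V_θ}` at a constant abelian background has, in EVERY orthonormal eigenframe,
# `Σ_modes modeZPE(κ·aᵢ) = 2·toronZPE L κ 0 0 + 4·toronZPE L κ 0 (2θ)` — neutral colour ×2 (plain curl), charged plane ×4 (twisted curl)
# (VALLEY term of S-BASE, crux `TwistedTraceScaling` stmt-QuantumFields-20203; design note `pub/ym-fleet/ym-luscher-20007-p1/COARSE-DESIGN.md`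
# §12 target signature `covCurl_abelianCfg_spectrum`)

`LinkSpace L = ℝ^{Edge × Fin 3}` splits orthogonally into the NEUTRAL colour `a = 0` (`≅ ℝ^{Edge}`, `neutralEmbed`) and the CHARGED plane
`a ∈ {1,2}` (`≅ ℂ^{Edge}` as a real space, `chargedEmbed w = (0, Re w, Im w)`).  By `…ToronCurl.covCurl_abelianCfg_apply` the covariant curl at
`V_θ = abelianCfg L θ` acts as the plain real curl `reCurl` on the neutral component and as the complex twisted curl `twCurl L (2θ)` on the charged
one (`covCurl_abelianCfg_neutralEmbed`, `covCurl_abelianCfg_chargedEmbed`), so `‖D_{V_θ} v‖² = ‖d v₀‖² + ‖D_{2θ} v_c‖²` (`norm_covCurl_abelianCfg_sq`).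
Gluing a real eigenframe of `d†d` (Mathlib) with the plane-wave frame of `…ToronSpectrum` and its `i`-multiple gives an explicit orthonormal frame
of `LinkSpace L` diagonalising `‖D_{V_θ}·‖²` (`linkFrame`, `isDiag_linkFrame`) whose zero-point sum is `2·toronZPE(0) + 4·toronZPE(2θ)`; frame
independence (`…ToronFrames`) transfers the sum to every eigenframe:
* ★★★ `sum_modeZPE_of_isDiag_covCurl_abelianCfg` (frame-free), ★★★ `covCurl_abelianCfg_spectrum` (the design signature: `∃ n e a, aᵢ ≥ 0 ∧
  ‖D v‖² = Σ aᵢ⟪eᵢ,v⟫² ∧ Σ modeZPE(κ aᵢ) = 2·toronZPE L κ 0 0 + 4·toronZPE L κ 0 (2θ)`), `sum_modeZPE_eigenvalues_covHessian_abelianCfg` (Mathlib's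
  eigenframe of `D†D`).
With `…ToronValley.prod_sqrt_pi_div_eq` this turns the harmonic normalisation at `V_θ` into `√(π/b)^{9L³}·e^{−[2·toronZPE(0)+4·toronZPE(2θ)]}` (at
`κ = t/b`), and `toronZPE_gain_of_valley` then yields the valley gain.

HONEST FRAMING: fixed-lattice linear algebra; femto rung R2b1 (brick for a stub of a child of a CONDITIONAL route); not a gap, not Clay.
-/

set_option autoImplicit false

noncomputable section

open Finset Module
open scoped BigOperators ComplexConjugate InnerProductSpace
open Literature.MathematicalPhysics.QuantumFieldTheory
open Literature.MathematicalPhysics.QuantumLattice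

namespace Summit.QuantumFields.YangMills.Theorems.FemtoTransferGap.TwoLattice.Toron

open Summit.QuantumFields.YangMills.Theorems.FemtoTransferGap
open Summit.QuantumFields.YangMills.Theorems.FemtoTransferGap.TwoLattice.Cov
open Summit.QuantumFields.YangMills.Theorems.FemtoTransferGap.TwoLattice.Stiff

variable (L : ℕ) [NeZero L]

/-! ## §1 The neutral / charged splitting of `LinkSpace` -/

/-- The neutral colour embedding `u ↦ (u, 0, 0)`. [cite: Luscher1983, §3] -/
def neutralEmbed (u : EuclideanSpace ℝ (Edge 3 L)) : LinkSpace L := WithLp.toLp 2 fun ea => ![u ea.1, 0, 0] ea.2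

/-- The charged plane embedding `w ↦ (0, Re w, Im w)` (the charged colours `1, 2` as one complex field). [cite: Luscher1983, §3] -/
def chargedEmbed (w : EuclideanSpace ℂ (Edge 3 L)) : LinkSpace L := WithLp.toLp 2 fun ea => ![0, (w ea.1).re, (w ea.1).im] ea.2

/-- The neutral component `v₀(e) = v(e; 0)`. [folklore] -/
def neutralPart (v : LinkSpace L) : EuclideanSpace ℝ (Edge 3 L) := WithLp.toLp 2 fun e => v (e, 0)

/-- The charged component `v_c(e) = v(e; 1) + i·v(e; 2)`. [folklore] -/
def chargedPart (v : LinkSpace L) : EuclideanSpace ℂ (Edge 3 L) := WithLp.toLp 2 fun e => ⟨v (e, 1), v (e, 2)⟩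

omit [NeZero L] in
/-- Components of the embeddings and parts. [folklore] -/
theorem embed_apply (u : EuclideanSpace ℝ (Edge 3 L)) (w : EuclideanSpace ℂ (Edge 3 L)) (v : LinkSpace L) (e : Edge 3 L) :
    neutralEmbed L u (e, 0) = u e ∧ neutralEmbed L u (e, 1) = 0 ∧ neutralEmbed L u (e, 2) = 0 ∧
    chargedEmbed L w (e, 0) = 0 ∧ chargedEmbed L w (e, 1) = (w e).re ∧ chargedEmbed L w (e, 2) = (w e).im ∧
    neutralPart L v e = v (e, 0) ∧ chargedPart L v e = ⟨v (e, 1), v (e, 2)⟩ :=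
  ⟨rfl, rfl, rfl, rfl, rfl, rfl, rfl, rfl⟩

/-- A real sum over `Edge × Fin 3` as a sum over edges of the three colour terms. [folklore] -/
theorem sum_edge_colour (f : Edge 3 L × Fin 3 → ℝ) : ∑ ea, f ea = ∑ e, (f (e, 0) + f (e, 1) + f (e, 2)) := by
  rw [Fintype.sum_prod_type]
  exact sum_congr rfl fun e _ => by rw [Fin.sum_univ_three]

omit [NeZero L] in
/-- **Decomposition** `v = (v₀, 0, 0) + (0, Re v_c, Im v_c)`. [folklore] -/
theorem neutralEmbed_add_chargedEmbed (v : LinkSpace L) : neutralEmbed L (neutralPart L v) + chargedEmbed L (chargedPart L v) = v := by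
  ext ⟨e, a⟩
  rw [PiLp.add_apply]
  fin_cases a
  · simp [neutralEmbed, chargedEmbed, neutralPart]
  · simp [neutralEmbed, chargedEmbed, chargedPart]
  · simp [neutralEmbed, chargedEmbed, chargedPart]

/-- Adjunction for the neutral colour: `⟪(u,0,0), v⟫ = ⟪u, v₀⟫`. [folklore] -/
theorem inner_neutralEmbed_left (u : EuclideanSpace ℝ (Edge 3 L)) (v : LinkSpace L) :
    ⟪neutralEmbed L u, v⟫_ℝ = ⟪u, neutralPart L v⟫_ℝ := by
  rw [PiLp.inner_apply, PiLp.inner_apply, sum_edge_colour]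
  refine sum_congr rfl fun e _ => ?_
  obtain ⟨h0, h1, h2, -, -, -, h6, -⟩ := embed_apply L u 0 v e
  rw [h0, h1, h2, h6]
  simp

/-- Adjunction for the charged plane: `⟪(0, Re w, Im w), v⟫ = Re⟪w, v_c⟫_ℂ`. [folklore] -/
theorem inner_chargedEmbed_left (w : EuclideanSpace ℂ (Edge 3 L)) (v : LinkSpace L) :
    ⟪chargedEmbed L w, v⟫_ℝ = (⟪w, chargedPart L v⟫_ℂ).re := by
  rw [PiLp.inner_apply, PiLp.inner_apply, sum_edge_colour, Complex.re_sum]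
  refine sum_congr rfl fun e _ => ?_
  obtain ⟨-, -, -, h3, h4, h5, -, h7⟩ := embed_apply L 0 w v e
  rw [h3, h4, h5, h7, RCLike.inner_apply]
  simp [Complex.mul_re]

/-- `⟪(0, Re(iw), Im(iw)), v⟫ = Im⟪w, v_c⟫_ℂ`. [folklore] -/
theorem inner_chargedEmbed_I_smul_left (w : EuclideanSpace ℂ (Edge 3 L)) (v : LinkSpace L) :
    ⟪chargedEmbed L (Complex.I • w), v⟫_ℝ = (⟪w, chargedPart L v⟫_ℂ).im := by
  rw [inner_chargedEmbed_left, inner_smul_left, Complex.conj_I]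
  simp

/-- The charged embedding is a real isometry in inner-product form: `⟪Φw, Φw'⟫ = Re⟪w, w'⟫_ℂ`. [folklore] -/
theorem inner_chargedEmbed (w w' : EuclideanSpace ℂ (Edge 3 L)) : ⟪chargedEmbed L w, chargedEmbed L w'⟫_ℝ = (⟪w, w'⟫_ℂ).re := by
  rw [inner_chargedEmbed_left]
  congr 2

/-- `⟪Ψu, Ψu'⟫ = ⟪u, u'⟫`. [folklore] -/
theorem inner_neutralEmbed (u u' : EuclideanSpace ℝ (Edge 3 L)) : ⟪neutralEmbed L u, neutralEmbed L u'⟫_ℝ = ⟪u, u'⟫_ℝ := by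
  rw [inner_neutralEmbed_left]
  congr 1

/-- The two sectors are orthogonal: `⟪Ψu, Φw⟫ = 0`. [folklore] -/
theorem inner_neutralEmbed_chargedEmbed (u : EuclideanSpace ℝ (Edge 3 L)) (w : EuclideanSpace ℂ (Edge 3 L)) :
    ⟪neutralEmbed L u, chargedEmbed L w⟫_ℝ = 0 := by
  rw [inner_neutralEmbed_left, PiLp.inner_apply]
  refine sum_eq_zero fun e _ => ?_
  obtain ⟨-, -, -, h3, -, -, h6, -⟩ := embed_apply L u w (chargedEmbed L w) e
  rw [h6, h3]
  simp

/-- Symmetrically `⟪Φw, Ψu⟫ = 0`. [folklore] -/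
theorem inner_chargedEmbed_neutralEmbed (w : EuclideanSpace ℂ (Edge 3 L)) (u : EuclideanSpace ℝ (Edge 3 L)) :
    ⟪chargedEmbed L w, neutralEmbed L u⟫_ℝ = 0 := by
  rw [real_inner_comm]; exact inner_neutralEmbed_chargedEmbed L u w

/-! ## §2 The covariant curl at `V_θ` on the two sectors -/

/-- Row `0` of `chargedRot`: `(1, 0, 0)`; rows `1, 2` have a zero in column `0`. [folklore] -/
theorem chargedRot_entries (φ : ℝ) :
    chargedRot φ 0 0 = 1 ∧ chargedRot φ 0 1 = 0 ∧ chargedRot φ 0 2 = 0 ∧ chargedRot φ 1 0 = 0 ∧ chargedRot φ 2 0 = 0 ∧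
    chargedRot φ 1 1 = Real.cos φ ∧ chargedRot φ 1 2 = -Real.sin φ ∧ chargedRot φ 2 1 = Real.sin φ ∧ chargedRot φ 2 2 = Real.cos φ := by
  simp [chargedRot]

omit [NeZero L] in
/-- ★ On the neutral sector `D_{V_θ}` is the plain curl: `D_{V_θ}(u,0,0) = ((d u), 0, 0)`. [cite: Luscher1983, §3] -/
theorem covCurl_abelianCfg_neutralEmbed (θ : Fin 3 → ℝ) (u : EuclideanSpace ℝ (Edge 3 L)) (p : Plaquette 3 L) (a : Fin 3) :
    covCurl (abelianCfg L θ) (neutralEmbed L u) (p, a) = ![reCurl L u p, 0, 0] a := by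
  obtain ⟨x, kl⟩ := p
  rw [covCurl_abelianCfg_apply]
  simp only [Fin.sum_univ_three, Fin.isValue]
  obtain ⟨r00, r01, r02, r10, r20, -, -, -, -⟩ := chargedRot_entries (2 * θ kl.1.1)
  obtain ⟨s00, s01, s02, s10, s20, -, -, -, -⟩ := chargedRot_entries (2 * θ kl.1.2)
  fin_cases a
  · simp [neutralEmbed, r00, r01, r02, s00, s01, s02, reCurl_apply]
  · simp [neutralEmbed, r10, s10]
  · simp [neutralEmbed, r20, s20]

omit [NeZero L] in
/-- ★ On the charged sector `D_{V_θ}` is the complex twisted curl with phases `2θ`: `D_{V_θ}(0, Re w, Im w) = (0, Re D_{2θ}w, Im D_{2θ}w)`.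
[cite: Luscher1983, §3] -/
theorem covCurl_abelianCfg_chargedEmbed (θ : Fin 3 → ℝ) (w : EuclideanSpace ℂ (Edge 3 L)) (p : Plaquette 3 L) (a : Fin 3) :
    covCurl (abelianCfg L θ) (chargedEmbed L w) (p, a) =
      ![0, (twCurl L (fun k => 2 * θ k) w p).re, (twCurl L (fun k => 2 * θ k) w p).im] a := by
  obtain ⟨x, kl⟩ := p
  rw [covCurl_abelianCfg_apply, twCurl_apply]
  simp only [Fin.sum_univ_three, Fin.isValue]
  obtain ⟨r00, r01, r02, r10, r20, r11, r12, r21, r22⟩ := chargedRot_entries (2 * θ kl.1.1)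
  obtain ⟨s00, s01, s02, s10, s20, s11, s12, s21, s22⟩ := chargedRot_entries (2 * θ kl.1.2)
  have e1 : twPhase (fun k => 2 * θ k) kl.1.1 = ⟨Real.cos (2 * θ kl.1.1), Real.sin (2 * θ kl.1.1)⟩ := by
    apply Complex.ext
    · exact Complex.exp_ofReal_mul_I_re _
    · exact Complex.exp_ofReal_mul_I_im _
  have e2 : twPhase (fun k => 2 * θ k) kl.1.2 = ⟨Real.cos (2 * θ kl.1.2), Real.sin (2 * θ kl.1.2)⟩ := by
    apply Complex.ext
    · exact Complex.exp_ofReal_mul_I_re _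
    · exact Complex.exp_ofReal_mul_I_im _
  fin_cases a
  · simp [chargedEmbed, r00, r01, r02, s00, s01, s02]
  · simp [chargedEmbed, r10, r11, r12, s10, s11, s12, e1, e2, Complex.mul_re]
    ring
  · simp [chargedEmbed, r20, r21, r22, s20, s21, s22, e1, e2, Complex.mul_im]
    ring

/-- ★★ **Sector splitting of the form**: `‖D_{V_θ} v‖² = ‖d v₀‖² + ‖D_{2θ} v_c‖²`. [cite: Luscher1983, §3] -/
theorem norm_covCurl_abelianCfg_sq (θ : Fin 3 → ℝ) (v : LinkSpace L) :
    ‖covCurl (abelianCfg L θ) v‖ ^ 2 = ‖reCurl L (neutralPart L v)‖ ^ 2 + ‖twCurl L (fun k => 2 * θ k) (chargedPart L v)‖ ^ 2 := by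
  conv_lhs => rw [← neutralEmbed_add_chargedEmbed L v]
  rw [map_add, EuclideanSpace.real_norm_sq_eq, EuclideanSpace.real_norm_sq_eq, EuclideanSpace.norm_sq_eq, ← sum_add_distrib,
    Fintype.sum_prod_type]
  refine sum_congr rfl fun p _ => ?_
  rw [Fin.sum_univ_three]
  simp only [Fin.isValue, PiLp.add_apply, covCurl_abelianCfg_neutralEmbed, covCurl_abelianCfg_chargedEmbed, Complex.sq_norm,
    Complex.normSq_apply]
  simp
  ring

/-! ## §3 An explicit eigenframe of `LinkSpace` at `V_θ` -/

/-- The momentum × polarisation index of the charged plane waves. [folklore] -/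
abbrev CIdx : Type := Site 3 L × Fin 3

/-- Index of the glued frame: neutral modes ⊕ (charged modes ⊕ their `i`-multiples). [folklore] -/
abbrev LIdx : Type := Fin (Fintype.card (Edge 3 L)) ⊕ (CIdx L ⊕ CIdx L)

/-- Mathlib's eigenframe of the neutral Hessian `d†d` on `ℝ^{Edge}`. [folklore] -/
def neutralFrame : OrthonormalBasis (Fin (Fintype.card (Edge 3 L))) ℝ (EuclideanSpace ℝ (Edge 3 L)) :=
  (LinearMap.isPositive_adjoint_comp_self (reCurl L)).isSymmetric.eigenvectorBasis finrank_euclideanSpace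

/-- Its eigenvalues. [folklore] -/
def neutralValue : Fin (Fintype.card (Edge 3 L)) → ℝ :=
  (LinearMap.isPositive_adjoint_comp_self (reCurl L)).isSymmetric.eigenvalues finrank_euclideanSpace

/-- The neutral eigenframe diagonalises `‖d·‖²`. [folklore] -/
theorem isDiag_neutralFrame : Frame.IsDiag (reCurl L) (neutralFrame L) (neutralValue L) :=
  Frame.isDiag_eigenvectorBasis (reCurl L) finrank_euclideanSpace

/-- The glued frame vectors of `LinkSpace L` at `V_θ`. [cite: Luscher1983, §3] -/
def linkFrameVec (θ : Fin 3 → ℝ) : LIdx L → LinkSpace L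
  | Sum.inl i => neutralEmbed L (neutralFrame L i)
  | Sum.inr (Sum.inl m) => chargedEmbed L (pwFrame L (fun k => 2 * θ k) m)
  | Sum.inr (Sum.inr m) => chargedEmbed L (Complex.I • pwFrame L (fun k => 2 * θ k) m)

/-- The glued values: neutral eigenvalues, and the plane-wave values twice. [cite: Luscher1983, §3] -/
def linkValue (θ : Fin 3 → ℝ) : LIdx L → ℝ
  | Sum.inl i => neutralValue L i
  | Sum.inr (Sum.inl m) => pwValue L (fun k => 2 * θ k) m
  | Sum.inr (Sum.inr m) => pwValue L (fun k => 2 * θ k) m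

/-- The glued frame is orthonormal. [folklore] -/
theorem orthonormal_linkFrameVec (θ : Fin 3 → ℝ) : Orthonormal ℝ (linkFrameVec L θ) := by
  classical
  have hgg : ∀ m m', ⟪pwFrame L (fun k => 2 * θ k) m, pwFrame L (fun k => 2 * θ k) m'⟫_ℂ = if m = m' then 1 else 0 :=
    orthonormal_iff_ite.mp (pwFrame L _).orthonormal
  have hnn : ∀ i i', ⟪neutralFrame L i, neutralFrame L i'⟫_ℝ = if i = i' then 1 else 0 :=
    orthonormal_iff_ite.mp (neutralFrame L).orthonormal
  rw [orthonormal_iff_ite]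
  rintro (i | m | m) (i' | m' | m')
  · simp only [linkFrameVec, inner_neutralEmbed, hnn, Sum.inl.injEq]
  · simp only [linkFrameVec, inner_neutralEmbed_chargedEmbed, reduceCtorEq, if_false]
  · simp only [linkFrameVec, inner_neutralEmbed_chargedEmbed, reduceCtorEq, if_false]
  · simp only [linkFrameVec, inner_chargedEmbed_neutralEmbed, reduceCtorEq, if_false]
  · simp only [linkFrameVec, inner_chargedEmbed, hgg, Sum.inr.injEq, Sum.inl.injEq]
    split_ifs <;> simp
  · simp only [linkFrameVec, inner_chargedEmbed, inner_smul_right, hgg, Sum.inr.injEq, reduceCtorEq, if_false]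
    split_ifs <;> simp
  · simp only [linkFrameVec, inner_chargedEmbed_neutralEmbed, reduceCtorEq, if_false]
  · simp only [linkFrameVec, inner_chargedEmbed, inner_smul_left, hgg, Sum.inr.injEq, reduceCtorEq, if_false]
    split_ifs <;> simp
  · simp only [linkFrameVec, inner_chargedEmbed, inner_smul_left, inner_smul_right, hgg, Sum.inr.injEq]
    split_ifs <;> simp

/-- Dimension count: `|Edge| + 2·|Site × Fin 3| = |Edge × Fin 3|` (`3L³ + 6L³ = 9L³`). [folklore] -/
theorem card_lIdx : Fintype.card (LIdx L) = finrank ℝ (LinkSpace L) := by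
  rw [finrank_euclideanSpace]
  simp only [Fintype.card_sum, Fintype.card_fin, Fintype.card_prod]
  ring

/-- ★ **The glued eigenframe** of `LinkSpace L` at `V_θ`. [cite: Luscher1983, §3] -/
def linkFrame (θ : Fin 3 → ℝ) : OrthonormalBasis (LIdx L) ℝ (LinkSpace L) :=
  OrthonormalBasis.mk (orthonormal_linkFrameVec L θ)
    ((orthonormal_linkFrameVec L θ).linearIndependent.span_eq_top_of_card_eq_finrank' (card_lIdx L)).ge

/-- Its vectors. [folklore] -/
theorem linkFrame_apply (θ : Fin 3 → ℝ) (I : LIdx L) : linkFrame L θ I = linkFrameVec L θ I := by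
  rw [linkFrame, OrthonormalBasis.coe_mk]

/-- ★★ **The form in the glued frame**: `‖D_{V_θ} v‖² = Σ_I linkValue_I · ⟪linkFrame_I, v⟫²`. [cite: Luscher1983, §3] -/
theorem norm_covCurl_abelianCfg_sq_eq_sum (θ : Fin 3 → ℝ) (v : LinkSpace L) :
    ‖covCurl (abelianCfg L θ) v‖ ^ 2 = ∑ I, linkValue L θ I * ⟪linkFrame L θ I, v⟫_ℝ ^ 2 := by
  rw [norm_covCurl_abelianCfg_sq, (isDiag_neutralFrame L).norm_sq_eq_sum_real,
    (isDiag_twCurl_pwFrame L (fun k => 2 * θ k)).norm_sq_eq_sum, Fintype.sum_sum_type, Fintype.sum_sum_type, ← sum_add_distrib]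
  congr 1
  · refine sum_congr rfl fun i _ => ?_
    rw [linkFrame_apply, linkValue, linkFrameVec, inner_neutralEmbed_left]
  · refine sum_congr rfl fun m _ => ?_
    rw [linkFrame_apply, linkFrame_apply, linkValue, linkValue, linkFrameVec, linkFrameVec, inner_chargedEmbed_left,
      inner_chargedEmbed_I_smul_left, Complex.sq_norm, Complex.normSq_apply]
    ring

/-- ★★ The glued frame diagonalises `‖D_{V_θ}·‖²` with values `linkValue`. [cite: Luscher1983, §3] -/
theorem isDiag_linkFrame (θ : Fin 3 → ℝ) : Frame.IsDiag (covCurl (abelianCfg L θ)) (linkFrame L θ) (linkValue L θ) := by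
  classical
  -- polarise the quadratic-form identity: both sides are symmetric bilinear forms
  have hq := norm_covCurl_abelianCfg_sq_eq_sum L θ
  have hpol : ∀ x y : LinkSpace L, ⟪covCurl (abelianCfg L θ) x, covCurl (abelianCfg L θ) y⟫_ℝ =
      ∑ I, linkValue L θ I * (⟪linkFrame L θ I, x⟫_ℝ * ⟪linkFrame L θ I, y⟫_ℝ) := fun x y => by
    have h1 := hq (x + y)
    have h2 := hq x
    have h3 := hq y
    rw [map_add, ← real_inner_self_eq_norm_sq, real_inner_add_add_self, real_inner_self_eq_norm_sq, real_inner_self_eq_norm_sq,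
      h2, h3] at h1
    simp_rw [inner_add_right, add_sq, mul_add, sum_add_distrib] at h1
    have h5 : ∑ I, linkValue L θ I * (2 * ⟪linkFrame L θ I, x⟫_ℝ * ⟪linkFrame L θ I, y⟫_ℝ) =
        2 * ∑ I, linkValue L θ I * (⟪linkFrame L θ I, x⟫_ℝ * ⟪linkFrame L θ I, y⟫_ℝ) := by
      rw [mul_sum]; exact sum_congr rfl fun I _ => by ring
    linarith
  intro I J
  rw [hpol]
  simp_rw [orthonormal_iff_ite.mp (linkFrame L θ).orthonormal]
  simp only [mul_ite, mul_one, mul_zero, Finset.sum_ite_eq', Finset.mem_univ, if_true, RCLike.ofReal_real_eq_id, id_eq]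
  by_cases h : I = J
  · subst h; simp
  · rw [if_neg h, if_neg (Ne.symm h)]

/-! ## §4 The zero-point sum at `V_θ`: frame-free, the design signature, and Mathlib's eigenframe -/

/-- The glued frame's zero-point sum. [cite: Luscher1983, §3] -/
theorem sum_modeZPE_linkValue (θ : Fin 3 → ℝ) (κ : ℝ) :
    ∑ I, modeZPE (κ * linkValue L θ I) = 2 * toronZPE L κ 0 0 + 4 * toronZPE L κ 0 (fun k => 2 * θ k) := by
  rw [Fintype.sum_sum_type, Fintype.sum_sum_type]
  simp only [linkValue]
  rw [sum_modeZPE_of_isDiag_reCurl L (isDiag_neutralFrame L) κ, sum_modeZPE_pwValue]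
  ring

/-- ★★★ **C3a SPECTRAL BRIDGE, frame-free**: for EVERY orthonormal frame `(e, a)` of `LinkSpace L` diagonalising `‖D_{V_θ}·‖²`
(`V_θ = abelianCfg L θ`), `Σᵢ modeZPE(κ aᵢ) = 2·toronZPE L κ 0 0 + 4·toronZPE L κ 0 (2θ)`. [cite: Luscher1983, §3] -/
theorem sum_modeZPE_of_isDiag_covCurl_abelianCfg (θ : Fin 3 → ℝ) {ι : Type*} [Fintype ι] [DecidableEq ι]
    {e : OrthonormalBasis ι ℝ (LinkSpace L)} {a : ι → ℝ} (h : Frame.IsDiag (covCurl (abelianCfg L θ)) e a) (κ : ℝ) :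
    ∑ i, modeZPE (κ * a i) = 2 * toronZPE L κ 0 0 + 4 * toronZPE L κ 0 (fun k => 2 * θ k) := by
  classical
  rw [h.sum_eq_sum (isDiag_linkFrame L θ) (fun y => modeZPE (κ * y)), sum_modeZPE_linkValue]

/-- ★★★ **C3a SPECTRAL BRIDGE (design signature of COARSE-DESIGN §12)**: the covariant Hessian at a constant abelian background has an orthonormal
eigenframe `(e, a)`, `aᵢ ≥ 0`, with `‖D_{V_θ} v‖² = Σᵢ aᵢ⟪eᵢ,v⟫²` and `Σᵢ modeZPE(κ aᵢ) = 2·toronZPE L κ 0 0 + 4·toronZPE L κ 0 (2θ)` (every `κ`).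
[cite: Luscher1983, §3] -/
theorem covCurl_abelianCfg_spectrum (θ : Fin 3 → ℝ) (κ : ℝ) :
    ∃ (n : ℕ) (e : OrthonormalBasis (Fin n) ℝ (LinkSpace L)) (a : Fin n → ℝ),
      (∀ i, 0 ≤ a i) ∧ (∀ v, ‖covCurl (abelianCfg L θ) v‖ ^ 2 = ∑ i, a i * ⟪e i, v⟫_ℝ ^ 2) ∧
      ∑ i, modeZPE (κ * a i) = 2 * toronZPE L κ 0 0 + 4 * toronZPE L κ 0 (fun k => 2 * θ k) := by
  classical
  have h := (isDiag_linkFrame L θ).reindex (Fintype.equivFin (LIdx L))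
  exact ⟨_, _, _, fun i => h.nonneg i, fun v => h.norm_sq_eq_sum_real v, sum_modeZPE_of_isDiag_covCurl_abelianCfg L θ h κ⟩

/-- The same for Mathlib's eigenframe of the covariant Hessian `D_{V_θ}† ∘ D_{V_θ}` (any eigen-enumeration `hn`). [cite: Luscher1983, §3] -/
theorem sum_modeZPE_eigenvalues_covHessian_abelianCfg (θ : Fin 3 → ℝ) {n : ℕ} (hn : finrank ℝ (LinkSpace L) = n) (κ : ℝ) :
    ∑ i, modeZPE (κ * (LinearMap.isPositive_adjoint_comp_self (covCurl (abelianCfg L θ))).isSymmetric.eigenvalues hn i) =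
      2 * toronZPE L κ 0 0 + 4 * toronZPE L κ 0 (fun k => 2 * θ k) :=
  sum_modeZPE_of_isDiag_covCurl_abelianCfg L θ (Frame.isDiag_eigenvectorBasis (covCurl (abelianCfg L θ)) hn) κ

end Summit.QuantumFields.YangMills.Theorems.FemtoTransferGap.TwoLattice.Toron

end
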